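import Mathlib.Algebra.BigOperators.Intervals
import Mathlib.Algebra.BigOperators.Ring.Finset
import Mathlib.Tactic.FieldSimp
import Mathlib.Tactic.Ring
import Mathlib.Tactic.Linarith
import Mathlib.Tactic.LinearCombination
import HarnessLib

/-!
# A three-term recurrence for the Racah / Kauffman–Lins alternating sum behind the `q`-6j symbols

For `p` in a field (`q = p²`), quantum integers `[m] = (pᵐ - p⁻ᵐ)/(p - p⁻¹)` (`m ∈ ℤ`), `[n]! = [1]⋯[n]`, and the
convention `1/[m]! = 0` for `m < 0`, the alternating sum

  `W(α;β) = Σ_z (-1)ᶻ [z+1]! / ([z-α₁]! [z-α₂]! [z-α₃]! [z-α₄]! [β₁-z]! [β₂-z]! [β₃-z]!)`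

(over the finite support `max αᵢ ≤ z ≤ min βₖ`; `αᵢ, βₖ ∈ ℤ`, `Σα = Σβ`) is the sum in Racah's single-sum formula for the
`6j`-symbol and in Kauffman–Lins' closed formula for the tetrahedral net `Tet[a b i; c d j]`
(`α = ((a+d+i)/2, (b+c+i)/2, (a+b+j)/2, (c+d+j)/2)`, `β = ((b+d+i+j)/2, (a+c+i+j)/2, (a+b+c+d)/2)`,
[cite: KauffmanLins1994, §9.11]). Kirillov–Reshetikhin identified these `q`-6j symbols with the `q`-Racah polynomials of
Askey–Wilson, whose three-term recurrence is Gasper–Rahman (7.2.1). This file proves the recurrence DIRECTLY for the sum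
`W`, in the `j`-direction `τ± = (α₁, α₂, α₃±1, α₄±1; β₁±1, β₂±1, β₃)` (with `j := β₁+β₂-α₁-α₂ = α₃+α₄-β₃`):

  `[j][j+1][j+2]·[β₁-α₃][β₂-α₄+1]·W(τ)
     = [j]·Π_{k,i∈{1,2}}[βₖ-αᵢ+1]·W(τ₊) + ([j]·Â + [j+2]·Ĉ)·W(τ) + [j+2]·[α₃+1][α₄+1][β₃-α₃+1][β₃-α₄+1]·W(τ₋)`,
  `Â = [β₂-α₁+1][β₂-α₂+1][β₃-α₃][α₃+2]`,  `Ĉ = [β₁-α₁][β₁-α₂][β₃-α₄+1][α₄+1]`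

(`racahW_threeTerm`), which after the Kirillov–Reshetikhin/Kauffman–Lins normalisation is the three-term recurrence
(7.2.1) of the `q`-Racah polynomials with the eigenvalue `[β₁-α₃][β₂-α₄+1] = [x][a-d+x+1]`, `x = (d+i-a)/2`
[cite: GasperRahman2004, §7.2 eq. (7.2.1)]. The proof is by creative telescoping with an explicit certificate
`Ĝ(z) = M'(z)·t_{(α₁+1,α₂+1,α₃,α₄;β₁+1,β₂+1,β₃)}(z)`, `M'` a Laurent polynomial of 64 monomials (`certL`, found with the
`q`-Zeilberger ansatz and verified here by `ring`): the termwise identity is `racahTerm_telescope`, the sums are taken over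
an integer window `[lo, lo+N)` containing the supports (`racahW`), and the only hypotheses are `p ≠ 0` and
`[m] ≠ 0` for `1 ≤ m ≤ Mx` where `Mx` bounds the factorial indices that occur — so the result applies verbatim at a root of
unity `p = e^{iπ/r}` as long as those indices stay below `r` (the use in
`RepresentationTheory/ModularTensorCategories/KLRecoupling*.lean`: orthogonality of the Kauffman–Lins `q`-6j symbols).
No named facts; nothing here depends on the representation-theoretic meaning of the sum.

## References

* L. H. Kauffman, S. L. Lins, *Temperley–Lieb Recoupling Theory and Invariants of 3-Manifolds* (1994), §9.11.
  [KauffmanLins1994]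
* G. Gasper, M. Rahman, *Basic Hypergeometric Series* (2004), §7.2. [GasperRahman2004]
-/

namespace Literature.Analysis.SpecialFunctions

open Finset

section Ring

variable {K : Type*} [CommRing K]

set_option maxRecDepth 20000 in
set_option maxHeartbeats 4000000 in
/-- The certificate polynomial `L(p; P, A₁…A₄, B₁, B₂)`: with `P = pᶻ`, `Aᵢ = p^{αᵢ}`, `Bₖ = p^{βₖ}` (`β₃` eliminated by
`Σα = Σβ`), the creative-telescoping multiplier is `M'(z) = L / (A₁²A₂²A₃A₄B₁³B₂³P²p⁶·(p-p⁻¹)⁵)` (64 monomials, found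
by the `q`-Zeilberger ansatz; it is a Laurent polynomial, i.e. has no other denominators). [folklore] -/
def certL (p P A1 A2 A3 A4 B1 B2 : K) : K :=
    ((-(p ^ 12 * A1 ^ 2 * A2 ^ 2 * A3 ^ 2 * A4 ^ 2 * B1 ^ 4 * B2 ^ 4) + p ^ 10 * P ^ 2 * A1 ^ 2 * A2 ^ 2 * A3 ^ 2 * A4 ^ 2 * B1 ^ 4 * B2 ^ 2 + p ^ 10 * P ^ 2 * A1 ^ 2 * A2 ^ 2 * A3 ^ 2 * A4 ^ 2 * B1 ^ 2 * B2 ^ 4 + p ^ 10 * P ^ 2 * A1 ^ 2 * A2 ^ 2 * B1 ^ 4 * B2 ^ 4 - (p ^ 10 * P ^ 2 * B1 ^ 6 * B2 ^ 6) + p ^ 10 * A3 ^ 2 * B1 ^ 6 * B2 ^ 6 + p ^ 10 * A4 ^ 2 * B1 ^ 6 * B2 ^ 6 - (p ^ 8 * P ^ 4 * A1 ^ 2 * A2 ^ 2 * A3 ^ 2 * A4 ^ 2 * B1 ^ 2 * B2 ^ 2)) : K) +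
    ((-(p ^ 8 * P ^ 2 * A1 ^ 2 * A2 ^ 2 * A3 ^ 2 * B1 ^ 4 * B2 ^ 2) - (p ^ 8 * P ^ 2 * A1 ^ 2 * A2 ^ 2 * A3 ^ 2 * B1 ^ 2 * B2 ^ 4) - (p ^ 8 * P ^ 2 * A1 ^ 2 * A2 ^ 2 * A4 ^ 2 * B1 ^ 4 * B2 ^ 2) - (p ^ 8 * P ^ 2 * A1 ^ 2 * A2 ^ 2 * A4 ^ 2 * B1 ^ 2 * B2 ^ 4) + p ^ 8 * A1 ^ 4 * A2 ^ 4 * A3 ^ 2 * A4 ^ 2 * B1 ^ 2 * B2 ^ 2 + p ^ 8 * A1 ^ 2 * A2 ^ 2 * A3 ^ 2 * A4 ^ 2 * B1 ^ 4 * B2 ^ 2 + p ^ 8 * A1 ^ 2 * A2 ^ 2 * A3 ^ 2 * A4 ^ 2 * B1 ^ 2 * B2 ^ 4 - (p ^ 8 * A3 ^ 2 * A4 ^ 2 * B1 ^ 6 * B2 ^ 4)) : K) +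
    ((-(p ^ 8 * A3 ^ 2 * A4 ^ 2 * B1 ^ 4 * B2 ^ 6) - (p ^ 8 * B1 ^ 6 * B2 ^ 6) - (p ^ 6 * P ^ 4 * A1 ^ 4 * A2 ^ 2 * B1 ^ 2 * B2 ^ 2) - (p ^ 6 * P ^ 4 * A1 ^ 2 * A2 ^ 4 * B1 ^ 2 * B2 ^ 2) + p ^ 6 * P ^ 4 * A1 ^ 2 * A2 ^ 2 * A3 ^ 2 * B1 ^ 2 * B2 ^ 2 + p ^ 6 * P ^ 4 * A1 ^ 2 * A2 ^ 2 * A4 ^ 2 * B1 ^ 2 * B2 ^ 2 + p ^ 6 * P ^ 4 * A1 ^ 2 * B1 ^ 4 * B2 ^ 4 + p ^ 6 * P ^ 4 * A2 ^ 2 * B1 ^ 4 * B2 ^ 4) : K) +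
    ((-(p ^ 6 * P ^ 2 * A1 ^ 4 * A2 ^ 4 * A3 ^ 2 * A4 ^ 2 * B1 ^ 2) - (p ^ 6 * P ^ 2 * A1 ^ 4 * A2 ^ 4 * A3 ^ 2 * A4 ^ 2 * B2 ^ 2) - (p ^ 6 * P ^ 2 * A1 ^ 4 * A2 ^ 4 * B1 ^ 2 * B2 ^ 2) + p ^ 6 * P ^ 2 * A1 ^ 4 * A2 ^ 2 * A3 ^ 2 * B1 ^ 2 * B2 ^ 2 + p ^ 6 * P ^ 2 * A1 ^ 4 * A2 ^ 2 * A4 ^ 2 * B1 ^ 2 * B2 ^ 2 + p ^ 6 * P ^ 2 * A1 ^ 2 * A2 ^ 4 * A3 ^ 2 * B1 ^ 2 * B2 ^ 2 + p ^ 6 * P ^ 2 * A1 ^ 2 * A2 ^ 4 * A4 ^ 2 * B1 ^ 2 * B2 ^ 2 - (p ^ 6 * P ^ 2 * A1 ^ 2 * A2 ^ 2 * A3 ^ 2 * A4 ^ 2 * B1 ^ 2 * B2 ^ 2)) : K) +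
    ((p ^ 6 * P ^ 2 * A1 ^ 2 * A2 ^ 2 * B1 ^ 4 * B2 ^ 4 - (p ^ 6 * P ^ 2 * A1 ^ 2 * A3 ^ 2 * B1 ^ 4 * B2 ^ 4) - (p ^ 6 * P ^ 2 * A1 ^ 2 * A4 ^ 2 * B1 ^ 4 * B2 ^ 4) - (p ^ 6 * P ^ 2 * A2 ^ 2 * A3 ^ 2 * B1 ^ 4 * B2 ^ 4) - (p ^ 6 * P ^ 2 * A2 ^ 2 * A4 ^ 2 * B1 ^ 4 * B2 ^ 4) + p ^ 6 * P ^ 2 * A3 ^ 2 * A4 ^ 2 * B1 ^ 4 * B2 ^ 4 + p ^ 6 * P ^ 2 * B1 ^ 6 * B2 ^ 4 + p ^ 6 * P ^ 2 * B1 ^ 4 * B2 ^ 6) : K) +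
    ((-(p ^ 6 * A1 ^ 4 * A2 ^ 2 * A3 ^ 2 * A4 ^ 2 * B1 ^ 2 * B2 ^ 2) - (p ^ 6 * A1 ^ 2 * A2 ^ 4 * A3 ^ 2 * A4 ^ 2 * B1 ^ 2 * B2 ^ 2) - (p ^ 6 * A1 ^ 2 * A2 ^ 2 * A3 ^ 2 * B1 ^ 4 * B2 ^ 4) - (p ^ 6 * A1 ^ 2 * A2 ^ 2 * A4 ^ 2 * B1 ^ 4 * B2 ^ 4) + p ^ 6 * A1 ^ 2 * A3 ^ 2 * A4 ^ 2 * B1 ^ 4 * B2 ^ 4 + p ^ 6 * A2 ^ 2 * A3 ^ 2 * A4 ^ 2 * B1 ^ 4 * B2 ^ 4 + p ^ 4 * P ^ 4 * A1 ^ 4 * A2 ^ 4 * A3 ^ 2 * A4 ^ 2 + p ^ 4 * P ^ 4 * A1 ^ 4 * A2 ^ 4 * B1 ^ 2) : K) +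
    ((p ^ 4 * P ^ 4 * A1 ^ 4 * A2 ^ 4 * B2 ^ 2 - (p ^ 4 * P ^ 4 * A1 ^ 2 * A2 ^ 2 * B1 ^ 4 * B2 ^ 2) - (p ^ 4 * P ^ 4 * A1 ^ 2 * A2 ^ 2 * B1 ^ 2 * B2 ^ 4) - (p ^ 4 * P ^ 4 * B1 ^ 4 * B2 ^ 4) + p ^ 4 * P ^ 2 * A1 ^ 2 * A2 ^ 2 * A3 ^ 2 * B1 ^ 4 * B2 ^ 2 + p ^ 4 * P ^ 2 * A1 ^ 2 * A2 ^ 2 * A3 ^ 2 * B1 ^ 2 * B2 ^ 4 + p ^ 4 * P ^ 2 * A1 ^ 2 * A2 ^ 2 * A4 ^ 2 * B1 ^ 4 * B2 ^ 2 + p ^ 4 * P ^ 2 * A1 ^ 2 * A2 ^ 2 * A4 ^ 2 * B1 ^ 2 * B2 ^ 4) : K) +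
    ((p ^ 4 * A1 ^ 2 * A2 ^ 2 * B1 ^ 4 * B2 ^ 4 - (p ^ 2 * P ^ 4 * A1 ^ 4 * A2 ^ 4 * A3 ^ 2) - (p ^ 2 * P ^ 4 * A1 ^ 4 * A2 ^ 4 * A4 ^ 2) + p ^ 2 * P ^ 2 * A1 ^ 4 * A2 ^ 4 * A3 ^ 2 * A4 ^ 2 - (p ^ 2 * P ^ 2 * A1 ^ 2 * A2 ^ 2 * A3 ^ 2 * A4 ^ 2 * B1 ^ 2 * B2 ^ 2) - (p ^ 2 * P ^ 2 * A1 ^ 2 * A2 ^ 2 * B1 ^ 4 * B2 ^ 2) - (p ^ 2 * P ^ 2 * A1 ^ 2 * A2 ^ 2 * B1 ^ 2 * B2 ^ 4) + P ^ 4 * A1 ^ 2 * A2 ^ 2 * B1 ^ 2 * B2 ^ 2) : K)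

end Ring

variable {K : Type*} [Field K]

/-- The quantum integer `[m] = (pᵐ - p⁻ᵐ)/(p - p⁻¹)`, `m ∈ ℤ` (so `[-m] = -[m]`, `[0] = 0`, `[1] = 1`).
[cite: KauffmanLins1994, §9.4] -/
def qBr (p : K) (m : ℤ) : K := (p ^ m - p ^ (-m)) / (p - p⁻¹)

/-- The quantum factorial `[n]! = [1][2]⋯[n]`. [cite: KauffmanLins1994, §9.4] -/
def qFac (p : K) (n : ℕ) : K := ∏ s ∈ range n, qBr p ((s : ℤ) + 1)

/-- `1/[m]!` extended by `0` for `m < 0` (the support convention of the Racah sum). [folklore] -/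
def qInvFac (p : K) (m : ℤ) : K := if m < 0 then 0 else (qFac p m.toNat)⁻¹

/-- The summand `t_{(α;β)}(z) = (-1)ᶻ [z+1]! Πᵢ (1/[z-αᵢ]!) Πₖ (1/[βₖ-z]!)` of the Racah / Kauffman–Lins sum
(meaningful for `z ≥ -1`). [cite: KauffmanLins1994, §9.11] -/
def racahTerm (p : K) (α₁ α₂ α₃ α₄ β₁ β₂ β₃ z : ℤ) : K :=
  (-1 : K) ^ z * qFac p (z + 1).toNat *
    (qInvFac p (z - α₁) * qInvFac p (z - α₂) * qInvFac p (z - α₃) * qInvFac p (z - α₄)) *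
    (qInvFac p (β₁ - z) * qInvFac p (β₂ - z) * qInvFac p (β₃ - z))

/-- The Racah / Kauffman–Lins sum over the integer window `lo ≤ z < lo + N` (equal to the sum over the support
`max αᵢ ≤ z ≤ min βₖ` whenever the window contains it, `racahTerm_eq_zero_of_lt/gt`). [cite: KauffmanLins1994, §9.11] -/
def racahW (p : K) (α₁ α₂ α₃ α₄ β₁ β₂ β₃ lo : ℤ) (N : ℕ) : K :=
  ∑ n ∈ range N, racahTerm p α₁ α₂ α₃ α₄ β₁ β₂ β₃ (lo + n)

/-! ### Elementary properties -/

/-- `[0] = 0`. [folklore] -/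
@[simp] theorem qBr_zero (p : K) : qBr p 0 = 0 := by simp [qBr]

/-- `[n+1]! = [n]!·[n+1]`. [folklore] -/
theorem qFac_succ (p : K) (n : ℕ) : qFac p (n + 1) = qFac p n * qBr p ((n : ℤ) + 1) := by
  simp [qFac, prod_range_succ]

/-- `1/[m]! = 0` for `m < 0`. [folklore] -/
theorem qInvFac_of_neg (p : K) {m : ℤ} (h : m < 0) : qInvFac p m = 0 := by simp [qInvFac, h]

/-- `1/[m]! = ([m]!)⁻¹` for `m ≥ 0`. [folklore] -/
theorem qInvFac_of_nonneg (p : K) {m : ℤ} (h : 0 ≤ m) : qInvFac p m = (qFac p m.toNat)⁻¹ := by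
  simp [qInvFac, not_lt.mpr h]

/-- The downward rule `1/[m-1]! = [m]·(1/[m]!)`, valid for all `m ≤ Mx` as soon as `[m'] ≠ 0` for `1 ≤ m' ≤ Mx`
(for `m ≤ 0` both sides vanish or `[0] = 0`). [folklore] -/
theorem qInvFac_sub_one (p : K) {Mx m : ℤ} (hbr : ∀ m' : ℤ, 1 ≤ m' → m' ≤ Mx → qBr p m' ≠ 0) (hm : m ≤ Mx) :
    qInvFac p (m - 1) = qBr p m * qInvFac p m := by
  rcases lt_trichotomy m 0 with h | rfl | h
  · rw [qInvFac_of_neg p (by omega), qInvFac_of_neg p h, mul_zero]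
  · simp [qInvFac]
  · have h1 : (1 : ℤ) ≤ m := h
    rw [qInvFac_of_nonneg p (by omega), qInvFac_of_nonneg p (by omega)]
    obtain ⟨n, rfl⟩ : ∃ n : ℕ, m = (n : ℤ) + 1 := ⟨(m - 1).toNat, by omega⟩
    rw [show ((n : ℤ) + 1 - 1).toNat = n by omega, show ((n : ℤ) + 1).toNat = n + 1 by omega, qFac_succ,
      mul_inv, ← mul_assoc, mul_comm (qBr p _) ((qFac p n)⁻¹), mul_assoc,
      mul_inv_cancel₀ (hbr _ h1 hm), mul_one]

/-- Two steps of the downward rule: `1/[m-2]! = [m-1][m]·(1/[m]!)`. [folklore] -/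
theorem qInvFac_sub_two (p : K) {Mx m : ℤ} (hbr : ∀ m' : ℤ, 1 ≤ m' → m' ≤ Mx → qBr p m' ≠ 0) (hm : m ≤ Mx) :
    qInvFac p (m - 2) = qBr p (m - 1) * qBr p m * qInvFac p m := by
  rw [show m - 2 = (m - 1) - 1 by ring, qInvFac_sub_one p hbr (by omega), qInvFac_sub_one p hbr hm, mul_assoc]

/-- The summand vanishes below the support: `z < αᵢ` for some `i`. [cite: KauffmanLins1994, §9.11] -/
theorem racahTerm_eq_zero_of_lt (p : K) {α₁ α₂ α₃ α₄ β₁ β₂ β₃ z : ℤ}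
    (h : z < α₁ ∨ z < α₂ ∨ z < α₃ ∨ z < α₄) : racahTerm p α₁ α₂ α₃ α₄ β₁ β₂ β₃ z = 0 := by
  unfold racahTerm
  rcases h with h | h | h | h
  · rw [qInvFac_of_neg p (show z - α₁ < 0 by omega)]; ring
  · rw [qInvFac_of_neg p (show z - α₂ < 0 by omega)]; ring
  · rw [qInvFac_of_neg p (show z - α₃ < 0 by omega)]; ring
  · rw [qInvFac_of_neg p (show z - α₄ < 0 by omega)]; ring

/-- The summand vanishes above the support: `βₖ < z` for some `k`. [cite: KauffmanLins1994, §9.11] -/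
theorem racahTerm_eq_zero_of_gt (p : K) {α₁ α₂ α₃ α₄ β₁ β₂ β₃ z : ℤ}
    (h : β₁ < z ∨ β₂ < z ∨ β₃ < z) : racahTerm p α₁ α₂ α₃ α₄ β₁ β₂ β₃ z = 0 := by
  unfold racahTerm
  rcases h with h | h | h
  · rw [qInvFac_of_neg p (show β₁ - z < 0 by omega)]; ring
  · rw [qInvFac_of_neg p (show β₂ - z < 0 by omega)]; ring
  · rw [qInvFac_of_neg p (show β₃ - z < 0 by omega)]; ring

/-! ### The certificate and the termwise identity -/

/-- The multiplier `M'(z) = L(p; pᶻ, p^α, p^β) / (p^{2α₁+2α₂+α₃+α₄+3β₁+3β₂+2z+6}·(p-p⁻¹)⁵)` of the certificate.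
[folklore] -/
def certM (p : K) (α₁ α₂ α₃ α₄ β₁ β₂ z : ℤ) : K :=
  certL p (p ^ z) (p ^ α₁) (p ^ α₂) (p ^ α₃) (p ^ α₄) (p ^ β₁) (p ^ β₂) /
    ((p ^ α₁) ^ 2 * (p ^ α₂) ^ 2 * p ^ α₃ * p ^ α₄ * (p ^ β₁) ^ 3 * (p ^ β₂) ^ 3 * (p ^ z) ^ 2 * p ^ 6 *
      (p - p⁻¹) ^ 5)

/-- The common core `C(z) = (-1)ᶻ [z+1]! Πᵢ (1/[z+1-αᵢ]!) · (1/[β₁+1-z]!)(1/[β₂+1-z]!)(1/[β₃-z]!)` out of which the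
three summands and the certificate factor. [folklore] -/
def racahCore (p : K) (α₁ α₂ α₃ α₄ β₁ β₂ β₃ z : ℤ) : K :=
  (-1 : K) ^ z * qFac p (z + 1).toNat *
    (qInvFac p (z + 1 - α₁) * qInvFac p (z + 1 - α₂) * qInvFac p (z + 1 - α₃) * qInvFac p (z + 1 - α₄)) *
    (qInvFac p (β₁ + 1 - z) * qInvFac p (β₂ + 1 - z) * qInvFac p (β₃ - z))

section Factor

variable (p : K) {Mx α₁ α₂ α₃ α₄ β₁ β₂ β₃ z : ℤ} (hbr : ∀ m' : ℤ, 1 ≤ m' → m' ≤ Mx → qBr p m' ≠ 0)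
  (h1 : z + 1 - α₁ ≤ Mx) (h2 : z + 1 - α₂ ≤ Mx) (h3 : z + 1 - α₃ ≤ Mx) (h4 : z + 1 - α₄ ≤ Mx)
  (k1 : β₁ + 1 - z ≤ Mx) (k2 : β₂ + 1 - z ≤ Mx) (k3 : β₃ - z ≤ Mx)
include hbr

/-- `t_τ(z) = C(z)·Πᵢ[z+1-αᵢ]·[β₁+1-z][β₂+1-z]`. [folklore] -/
theorem racahTerm_eq_core (h1 : z + 1 - α₁ ≤ Mx) (h2 : z + 1 - α₂ ≤ Mx) (h3 : z + 1 - α₃ ≤ Mx)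
    (h4 : z + 1 - α₄ ≤ Mx) (k1 : β₁ + 1 - z ≤ Mx) (k2 : β₂ + 1 - z ≤ Mx) :
    racahTerm p α₁ α₂ α₃ α₄ β₁ β₂ β₃ z = racahCore p α₁ α₂ α₃ α₄ β₁ β₂ β₃ z *
      (qBr p (z + 1 - α₁) * qBr p (z + 1 - α₂) * qBr p (z + 1 - α₃) * qBr p (z + 1 - α₄) *
        (qBr p (β₁ + 1 - z) * qBr p (β₂ + 1 - z))) := by
  unfold racahTerm racahCore
  rw [show z - α₁ = (z + 1 - α₁) - 1 by ring, qInvFac_sub_one p hbr h1,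
    show z - α₂ = (z + 1 - α₂) - 1 by ring, qInvFac_sub_one p hbr h2,
    show z - α₃ = (z + 1 - α₃) - 1 by ring, qInvFac_sub_one p hbr h3,
    show z - α₄ = (z + 1 - α₄) - 1 by ring, qInvFac_sub_one p hbr h4,
    show β₁ - z = (β₁ + 1 - z) - 1 by ring, qInvFac_sub_one p hbr k1,
    show β₂ - z = (β₂ + 1 - z) - 1 by ring, qInvFac_sub_one p hbr k2]
  ring

/-- `t_{τ₊}(z) = C(z)·[z+1-α₁][z+1-α₂]·[z-α₃][z+1-α₃][z-α₄][z+1-α₄]`. [folklore] -/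
theorem racahTerm_plus_eq_core (h1 : z + 1 - α₁ ≤ Mx) (h2 : z + 1 - α₂ ≤ Mx) (h3 : z + 1 - α₃ ≤ Mx)
    (h4 : z + 1 - α₄ ≤ Mx) :
    racahTerm p α₁ α₂ (α₃ + 1) (α₄ + 1) (β₁ + 1) (β₂ + 1) β₃ z = racahCore p α₁ α₂ α₃ α₄ β₁ β₂ β₃ z *
      (qBr p (z + 1 - α₁) * qBr p (z + 1 - α₂) *
        (qBr p (z - α₃) * qBr p (z + 1 - α₃) * qBr p (z - α₄) * qBr p (z + 1 - α₄))) := by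
  unfold racahTerm racahCore
  rw [show z - α₁ = (z + 1 - α₁) - 1 by ring, qInvFac_sub_one p hbr h1,
    show z - α₂ = (z + 1 - α₂) - 1 by ring, qInvFac_sub_one p hbr h2,
    show z - (α₃ + 1) = (z + 1 - α₃) - 2 by ring, qInvFac_sub_two p hbr h3,
    show z - (α₄ + 1) = (z + 1 - α₄) - 2 by ring, qInvFac_sub_two p hbr h4,
    show β₁ + 1 - z = β₁ + 1 - z by rfl, show β₂ + 1 - z = β₂ + 1 - z by rfl,
    show z + 1 - α₃ - 1 = z - α₃ by ring, show z + 1 - α₄ - 1 = z - α₄ by ring]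
  ring

/-- `t_{τ₋}(z) = C(z)·[z+1-α₁][z+1-α₂]·[β₁-z][β₁+1-z][β₂-z][β₂+1-z]`. [folklore] -/
theorem racahTerm_minus_eq_core (h1 : z + 1 - α₁ ≤ Mx) (h2 : z + 1 - α₂ ≤ Mx) (k1 : β₁ + 1 - z ≤ Mx)
    (k2 : β₂ + 1 - z ≤ Mx) :
    racahTerm p α₁ α₂ (α₃ - 1) (α₄ - 1) (β₁ - 1) (β₂ - 1) β₃ z = racahCore p α₁ α₂ α₃ α₄ β₁ β₂ β₃ z *
      (qBr p (z + 1 - α₁) * qBr p (z + 1 - α₂) *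
        (qBr p (β₁ - z) * qBr p (β₁ + 1 - z) * qBr p (β₂ - z) * qBr p (β₂ + 1 - z))) := by
  unfold racahTerm racahCore
  rw [show z - α₁ = (z + 1 - α₁) - 1 by ring, qInvFac_sub_one p hbr h1,
    show z - α₂ = (z + 1 - α₂) - 1 by ring, qInvFac_sub_one p hbr h2,
    show z - (α₃ - 1) = z + 1 - α₃ by ring, show z - (α₄ - 1) = z + 1 - α₄ by ring,
    show β₁ - 1 - z = (β₁ + 1 - z) - 2 by ring, qInvFac_sub_two p hbr k1,
    show β₂ - 1 - z = (β₂ + 1 - z) - 2 by ring, qInvFac_sub_two p hbr k2,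
    show β₁ + 1 - z - 1 = β₁ - z by ring, show β₂ + 1 - z - 1 = β₂ - z by ring]
  ring

/-- The certificate summand at `z`: `t_{(α₁+1,α₂+1,α₃,α₄;β₁+1,β₂+1,β₃)}(z) = C(z)·[z-α₁][z+1-α₁][z-α₂][z+1-α₂][z+1-α₃][z+1-α₄]`.
[folklore] -/
theorem racahTerm_cert_eq_core (h1 : z + 1 - α₁ ≤ Mx) (h2 : z + 1 - α₂ ≤ Mx) (h3 : z + 1 - α₃ ≤ Mx)
    (h4 : z + 1 - α₄ ≤ Mx) :
    racahTerm p (α₁ + 1) (α₂ + 1) α₃ α₄ (β₁ + 1) (β₂ + 1) β₃ z = racahCore p α₁ α₂ α₃ α₄ β₁ β₂ β₃ z *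
      (qBr p (z - α₁) * qBr p (z + 1 - α₁) * qBr p (z - α₂) * qBr p (z + 1 - α₂) *
        qBr p (z + 1 - α₃) * qBr p (z + 1 - α₄)) := by
  unfold racahTerm racahCore
  rw [show z - (α₁ + 1) = (z + 1 - α₁) - 2 by ring, qInvFac_sub_two p hbr h1,
    show z - (α₂ + 1) = (z + 1 - α₂) - 2 by ring, qInvFac_sub_two p hbr h2,
    show z - α₃ = (z + 1 - α₃) - 1 by ring, qInvFac_sub_one p hbr h3,
    show z - α₄ = (z + 1 - α₄) - 1 by ring, qInvFac_sub_one p hbr h4,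
    show z + 1 - α₁ - 1 = z - α₁ by ring, show z + 1 - α₂ - 1 = z - α₂ by ring]
  ring

/-- The certificate summand at `z+1`:
`t_{(α₁+1,α₂+1,α₃,α₄;β₁+1,β₂+1,β₃)}(z+1) = -C(z)·[z+2][z+1-α₁][z+1-α₂][β₁+1-z][β₂+1-z][β₃-z]` (`z ≥ -1`). [folklore] -/
theorem racahTerm_cert_succ_eq_core (hz : -1 ≤ z) (h1 : z + 1 - α₁ ≤ Mx) (h2 : z + 1 - α₂ ≤ Mx)
    (k1 : β₁ + 1 - z ≤ Mx) (k2 : β₂ + 1 - z ≤ Mx) (k3 : β₃ - z ≤ Mx) :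
    racahTerm p (α₁ + 1) (α₂ + 1) α₃ α₄ (β₁ + 1) (β₂ + 1) β₃ (z + 1) = racahCore p α₁ α₂ α₃ α₄ β₁ β₂ β₃ z *
      (-(qBr p (z + 2) * qBr p (z + 1 - α₁) * qBr p (z + 1 - α₂) *
        (qBr p (β₁ + 1 - z) * qBr p (β₂ + 1 - z) * qBr p (β₃ - z)))) := by
  unfold racahTerm racahCore
  have hneg : (-1 : K) ≠ 0 := neg_ne_zero.mpr one_ne_zero
  rw [show (z + 1 + 1).toNat = (z + 1).toNat + 1 by omega, qFac_succ,
    show (((z + 1).toNat : ℕ) : ℤ) + 1 = z + 2 by omega, zpow_add₀ hneg, zpow_one,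
    show z + 1 - (α₁ + 1) = (z + 1 - α₁) - 1 by ring, qInvFac_sub_one p hbr h1,
    show z + 1 - (α₂ + 1) = (z + 1 - α₂) - 1 by ring, qInvFac_sub_one p hbr h2,
    show β₁ + 1 - (z + 1) = (β₁ + 1 - z) - 1 by ring, qInvFac_sub_one p hbr k1,
    show β₂ + 1 - (z + 1) = (β₂ + 1 - z) - 1 by ring, qInvFac_sub_one p hbr k2,
    show β₃ - (z + 1) = (β₃ - z) - 1 by ring, qInvFac_sub_one p hbr k3]
  ring

end Factor

set_option maxRecDepth 20000 in
set_option maxHeartbeats 16000000 in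
/-- The bracket identity behind the telescoping (the certificate identity divided by the core): with
`j = β₁+β₂-α₁-α₂` and `β₃ = Σα - β₁ - β₂`,
`c₊'·Π₊ + c₀'·Π₀ + c₋'·Π₋ + M'(z+1)·Π_{G,1} + M'(z)·Π_G = 0`. Proof: clear denominators, `ring`. [folklore] -/
theorem racah_bracket_identity (p : K) (hp : p ≠ 0) (α₁ α₂ α₃ α₄ β₁ β₂ β₃ z : ℤ)
    (hbal : β₁ + β₂ + β₃ = α₁ + α₂ + α₃ + α₄) :
    qBr p (β₁ + β₂ - α₁ - α₂) * qBr p (β₁ - α₁ + 1) * qBr p (β₁ - α₂ + 1) * qBr p (β₂ - α₁ + 1) *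
          qBr p (β₂ - α₂ + 1) *
        (qBr p (z + 1 - α₁) * qBr p (z + 1 - α₂) *
          (qBr p (z - α₃) * qBr p (z + 1 - α₃) * qBr p (z - α₄) * qBr p (z + 1 - α₄))) +
      (qBr p (β₁ + β₂ - α₁ - α₂) * qBr p (β₂ - α₁ + 1) * qBr p (β₂ - α₂ + 1) * qBr p (β₃ - α₃) *
            qBr p (α₃ + 2) +
          qBr p (β₁ + β₂ - α₁ - α₂ + 2) * qBr p (β₁ - α₁) * qBr p (β₁ - α₂) * qBr p (β₃ - α₄ + 1) *
            qBr p (α₄ + 1) -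
          qBr p (β₁ + β₂ - α₁ - α₂) * qBr p (β₁ + β₂ - α₁ - α₂ + 1) * qBr p (β₁ + β₂ - α₁ - α₂ + 2) *
            qBr p (β₁ - α₃) * qBr p (β₂ - α₄ + 1)) *
        (qBr p (z + 1 - α₁) * qBr p (z + 1 - α₂) * qBr p (z + 1 - α₃) * qBr p (z + 1 - α₄) *
          (qBr p (β₁ + 1 - z) * qBr p (β₂ + 1 - z))) +
      qBr p (β₁ + β₂ - α₁ - α₂ + 2) * qBr p (α₃ + 1) * qBr p (α₄ + 1) * qBr p (β₃ - α₃ + 1) *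
          qBr p (β₃ - α₄ + 1) *
        (qBr p (z + 1 - α₁) * qBr p (z + 1 - α₂) *
          (qBr p (β₁ - z) * qBr p (β₁ + 1 - z) * qBr p (β₂ - z) * qBr p (β₂ + 1 - z))) +
      certM p α₁ α₂ α₃ α₄ β₁ β₂ (z + 1) *
        (qBr p (z + 2) * qBr p (z + 1 - α₁) * qBr p (z + 1 - α₂) *
          (qBr p (β₁ + 1 - z) * qBr p (β₂ + 1 - z) * qBr p (β₃ - z))) +
      certM p α₁ α₂ α₃ α₄ β₁ β₂ z *
        (qBr p (z - α₁) * qBr p (z + 1 - α₁) * qBr p (z - α₂) * qBr p (z + 1 - α₂) *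
          qBr p (z + 1 - α₃) * qBr p (z + 1 - α₄)) = 0 := by
  obtain rfl : β₃ = α₁ + α₂ + α₃ + α₄ - β₁ - β₂ := by omega
  have hP : p ^ z ≠ 0 := zpow_ne_zero _ hp
  have hA1 : p ^ α₁ ≠ 0 := zpow_ne_zero _ hp
  have hA2 : p ^ α₂ ≠ 0 := zpow_ne_zero _ hp
  have hA3 : p ^ α₃ ≠ 0 := zpow_ne_zero _ hp
  have hA4 : p ^ α₄ ≠ 0 := zpow_ne_zero _ hp
  have hB1 : p ^ β₁ ≠ 0 := zpow_ne_zero _ hp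
  have hB2 : p ^ β₂ ≠ 0 := zpow_ne_zero _ hp
  unfold certM
  simp only [qBr, zpow_add₀ hp, zpow_sub₀ hp, zpow_neg, zpow_ofNat]
  unfold certL
  field_simp
  ring

/-- The termwise (WZ-type) identity: for `z` in range,
`c₊'·t_{τ₊}(z) + c₀'·t_τ(z) + c₋'·t_{τ₋}(z) = Ĝ(z+1) - Ĝ(z)` with `Ĝ(z) = M'(z)·t_{(α₁+1,α₂+1,α₃,α₄;β₁+1,β₂+1,β₃)}(z)`.
[folklore] -/
theorem racahTerm_telescope (p : K) (hp : p ≠ 0) {Mx α₁ α₂ α₃ α₄ β₁ β₂ β₃ z : ℤ}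
    (hbal : β₁ + β₂ + β₃ = α₁ + α₂ + α₃ + α₄) (hbr : ∀ m' : ℤ, 1 ≤ m' → m' ≤ Mx → qBr p m' ≠ 0)
    (hz : -1 ≤ z) (h1 : z + 1 - α₁ ≤ Mx) (h2 : z + 1 - α₂ ≤ Mx) (h3 : z + 1 - α₃ ≤ Mx) (h4 : z + 1 - α₄ ≤ Mx)
    (k1 : β₁ + 1 - z ≤ Mx) (k2 : β₂ + 1 - z ≤ Mx) (k3 : β₃ - z ≤ Mx) :
    qBr p (β₁ + β₂ - α₁ - α₂) * qBr p (β₁ - α₁ + 1) * qBr p (β₁ - α₂ + 1) * qBr p (β₂ - α₁ + 1) *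
          qBr p (β₂ - α₂ + 1) * racahTerm p α₁ α₂ (α₃ + 1) (α₄ + 1) (β₁ + 1) (β₂ + 1) β₃ z +
      (qBr p (β₁ + β₂ - α₁ - α₂) * qBr p (β₂ - α₁ + 1) * qBr p (β₂ - α₂ + 1) * qBr p (β₃ - α₃) *
            qBr p (α₃ + 2) +
          qBr p (β₁ + β₂ - α₁ - α₂ + 2) * qBr p (β₁ - α₁) * qBr p (β₁ - α₂) * qBr p (β₃ - α₄ + 1) *
            qBr p (α₄ + 1) -
          qBr p (β₁ + β₂ - α₁ - α₂) * qBr p (β₁ + β₂ - α₁ - α₂ + 1) * qBr p (β₁ + β₂ - α₁ - α₂ + 2) *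
            qBr p (β₁ - α₃) * qBr p (β₂ - α₄ + 1)) * racahTerm p α₁ α₂ α₃ α₄ β₁ β₂ β₃ z +
      qBr p (β₁ + β₂ - α₁ - α₂ + 2) * qBr p (α₃ + 1) * qBr p (α₄ + 1) * qBr p (β₃ - α₃ + 1) *
          qBr p (β₃ - α₄ + 1) * racahTerm p α₁ α₂ (α₃ - 1) (α₄ - 1) (β₁ - 1) (β₂ - 1) β₃ z =
    certM p α₁ α₂ α₃ α₄ β₁ β₂ (z + 1) * racahTerm p (α₁ + 1) (α₂ + 1) α₃ α₄ (β₁ + 1) (β₂ + 1) β₃ (z + 1) -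
      certM p α₁ α₂ α₃ α₄ β₁ β₂ z * racahTerm p (α₁ + 1) (α₂ + 1) α₃ α₄ (β₁ + 1) (β₂ + 1) β₃ z := by
  rw [racahTerm_plus_eq_core p hbr h1 h2 h3 h4, racahTerm_eq_core p hbr h1 h2 h3 h4 k1 k2,
    racahTerm_minus_eq_core p hbr h1 h2 k1 k2, racahTerm_cert_eq_core p hbr h1 h2 h3 h4,
    racahTerm_cert_succ_eq_core p hbr hz h1 h2 k1 k2 k3]
  have key := racah_bracket_identity p hp α₁ α₂ α₃ α₄ β₁ β₂ β₃ z hbal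
  linear_combination racahCore p α₁ α₂ α₃ α₄ β₁ β₂ β₃ z * key

/-! ### The three-term recurrence -/

/-- **Three-term recurrence of the Racah / Kauffman–Lins sum in the `j`-direction** (the `q`-Racah three-term recurrence
in Racah-sum form). Window form: for the sums `W(τ), W(τ₊), W(τ₋)` over `lo ≤ z < lo+N` with `0 ≤ lo ≤ α₁`,
`β₃ < lo+N`, and `[m] ≠ 0` for `1 ≤ m ≤ Mx` where `Mx ≥ lo+N-αᵢ, βₖ+1-lo` (`k = 1,2`), `β₃-lo`:
`[j][j+1][j+2][β₁-α₃][β₂-α₄+1]·W(τ) = [j]Π[βₖ-αᵢ+1]·W(τ₊) + ([j]Â + [j+2]Ĉ)·W(τ) + [j+2][α₃+1][α₄+1][β₃-α₃+1][β₃-α₄+1]·W(τ₋)`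
(`j = β₁+β₂-α₁-α₂`). [cite: GasperRahman2004, §7.2 eq. (7.2.1)] -/
theorem racahW_threeTerm (p : K) (hp : p ≠ 0) {Mx α₁ α₂ α₃ α₄ β₁ β₂ β₃ lo : ℤ} {N : ℕ}
    (hbal : β₁ + β₂ + β₃ = α₁ + α₂ + α₃ + α₄) (hbr : ∀ m' : ℤ, 1 ≤ m' → m' ≤ Mx → qBr p m' ≠ 0)
    (hlo : 0 ≤ lo) (hlo1 : lo ≤ α₁) (hN : β₃ < lo + N)
    (hA1 : lo + N - α₁ ≤ Mx) (hA2 : lo + N - α₂ ≤ Mx) (hA3 : lo + N - α₃ ≤ Mx) (hA4 : lo + N - α₄ ≤ Mx)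
    (hB1 : β₁ + 1 - lo ≤ Mx) (hB2 : β₂ + 1 - lo ≤ Mx) (hB3 : β₃ - lo ≤ Mx) :
    qBr p (β₁ + β₂ - α₁ - α₂) * qBr p (β₁ + β₂ - α₁ - α₂ + 1) * qBr p (β₁ + β₂ - α₁ - α₂ + 2) *
        (qBr p (β₁ - α₃) * qBr p (β₂ - α₄ + 1)) * racahW p α₁ α₂ α₃ α₄ β₁ β₂ β₃ lo N =
      qBr p (β₁ + β₂ - α₁ - α₂) * (qBr p (β₁ - α₁ + 1) * qBr p (β₁ - α₂ + 1) * qBr p (β₂ - α₁ + 1) *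
          qBr p (β₂ - α₂ + 1)) * racahW p α₁ α₂ (α₃ + 1) (α₄ + 1) (β₁ + 1) (β₂ + 1) β₃ lo N +
      (qBr p (β₁ + β₂ - α₁ - α₂) *
            (qBr p (β₂ - α₁ + 1) * qBr p (β₂ - α₂ + 1) * qBr p (β₃ - α₃) * qBr p (α₃ + 2)) +
          qBr p (β₁ + β₂ - α₁ - α₂ + 2) *
            (qBr p (β₁ - α₁) * qBr p (β₁ - α₂) * qBr p (β₃ - α₄ + 1) * qBr p (α₄ + 1))) *
        racahW p α₁ α₂ α₃ α₄ β₁ β₂ β₃ lo N +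
      qBr p (β₁ + β₂ - α₁ - α₂ + 2) *
          (qBr p (α₃ + 1) * qBr p (α₄ + 1) * qBr p (β₃ - α₃ + 1) * qBr p (β₃ - α₄ + 1)) *
        racahW p α₁ α₂ (α₃ - 1) (α₄ - 1) (β₁ - 1) (β₂ - 1) β₃ lo N := by
  -- sum the termwise identity over the window and telescope
  set G : ℕ → K := fun n => certM p α₁ α₂ α₃ α₄ β₁ β₂ (lo + n) *
    racahTerm p (α₁ + 1) (α₂ + 1) α₃ α₄ (β₁ + 1) (β₂ + 1) β₃ (lo + n) with hG
  have hsum : ∀ n ∈ range N,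
      qBr p (β₁ + β₂ - α₁ - α₂) * qBr p (β₁ - α₁ + 1) * qBr p (β₁ - α₂ + 1) * qBr p (β₂ - α₁ + 1) *
            qBr p (β₂ - α₂ + 1) * racahTerm p α₁ α₂ (α₃ + 1) (α₄ + 1) (β₁ + 1) (β₂ + 1) β₃ (lo + n) +
        (qBr p (β₁ + β₂ - α₁ - α₂) * qBr p (β₂ - α₁ + 1) * qBr p (β₂ - α₂ + 1) * qBr p (β₃ - α₃) *
              qBr p (α₃ + 2) +
            qBr p (β₁ + β₂ - α₁ - α₂ + 2) * qBr p (β₁ - α₁) * qBr p (β₁ - α₂) * qBr p (β₃ - α₄ + 1) *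
              qBr p (α₄ + 1) -
            qBr p (β₁ + β₂ - α₁ - α₂) * qBr p (β₁ + β₂ - α₁ - α₂ + 1) * qBr p (β₁ + β₂ - α₁ - α₂ + 2) *
              qBr p (β₁ - α₃) * qBr p (β₂ - α₄ + 1)) * racahTerm p α₁ α₂ α₃ α₄ β₁ β₂ β₃ (lo + n) +
        qBr p (β₁ + β₂ - α₁ - α₂ + 2) * qBr p (α₃ + 1) * qBr p (α₄ + 1) * qBr p (β₃ - α₃ + 1) *
            qBr p (β₃ - α₄ + 1) * racahTerm p α₁ α₂ (α₃ - 1) (α₄ - 1) (β₁ - 1) (β₂ - 1) β₃ (lo + n) =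
      G (n + 1) - G n := by
    intro n hn
    have hn' : (n : ℤ) < N := by exact_mod_cast mem_range.mp hn
    rw [hG]
    simp only
    rw [show lo + ((n + 1 : ℕ) : ℤ) = lo + n + 1 by push_cast; ring]
    exact racahTerm_telescope p hp hbal hbr (by omega) (by omega) (by omega) (by omega) (by omega)
      (by omega) (by omega) (by omega)
  have htel : ∑ n ∈ range N, (G (n + 1) - G n) = G N - G 0 := sum_range_sub G N
  have hG0 : G 0 = 0 := by
    rw [hG]
    simp only [Nat.cast_zero, add_zero]
    rw [racahTerm_eq_zero_of_lt p (Or.inl (by omega)), mul_zero]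
  have hGN : G N = 0 := by
    rw [hG]
    simp only
    rw [racahTerm_eq_zero_of_gt p (Or.inr (Or.inr (by omega))), mul_zero]
  rw [hG0, hGN, sub_zero, ← sum_congr rfl hsum, sum_add_distrib, sum_add_distrib, ← mul_sum, ← mul_sum,
    ← mul_sum] at htel
  unfold racahW
  linear_combination -htel

end Literature.Analysis.SpecialFunctions
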